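import Literature.Analysis.FunctionSpaces.TorusGevreyInterpolation
import HarnessLib

/-!
# Gevrey interpolation on the lattice (tools stub `stub_gevreyInterpolationTools`, block N-R T7,
# line `ergodic-budget-selection-closing`, crux `BaireTransfer.DenseLoudDesignerForces`, stmt-AnomalousDissipation-1143)

Summit-side restatement (complex Euclidean target `ℂ^d`, general index type `d`) of the Literature theorem
`Torus.exists_sobolev_le_of_gevreyBound_of_l2_le` (`Literature/Analysis/FunctionSpaces/TorusGevreyInterpolation.lean`):
for `σ > 0`, `G ≥ 0`, `m : ℕ` and `ε > 0` there is `δ > 0` such that every coefficient family `c : ℤ^d → ℂ^d` on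
the Gevrey ball `∑_{k∈S} e^{2σ|k|} ‖c k‖² ≤ G` (all finite `S ⊆ ℤ^d`; the classes `D(e^{σA^{1/2}})` of
Foias–Temam 1989, produced along bounded-enstrophy Navier–Stokes trajectories by the Gevrey smoothing tools of
block N) which is `ℓ²`-small, `∑_{k∈S} ‖c k‖² ≤ δ`, is small in every polynomially weighted norm,
`∑_{k∈S} (1 + |k|²)^m ‖c k‖² ≤ ε` — the lattice form of "`L²`-small and Gevrey-bounded `⇒` `H^m`-small", by
which `L²`-statements along the Gevrey tube of the smooth-model construction upgrade to every Sobolev norm.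

Proof (in the Literature file): the termwise low/high-frequency split
`(1 + |k|²)^m ≤ (1 + R²)^m + K e^{-σR} e^{2σ|k|}`, `K = (2m)! σ^{-2m} e^{σ}` (`(1 + t²)^m e^{-σt} ≤ K`), summed
against `‖c k‖²`: `∑_S (1 + |k|²)^m ‖c k‖² ≤ (1 + R²)^m δ + K e^{-σR} G ≤ ε/2 + ε/2` for `R = 2KG/(εσ)` and
`δ = ε / (2 (1 + R²)^m)`.  The registered tools stub `stub_gevreyInterpolationTools` is proved BY NAME with exactly
the registered signature.

References: C. Foias, R. Temam, J. Funct. Anal. 87 (1989) 359–369; P. Constantin, C. Foias, *Navier–Stokes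
Equations* (1988), Ch. 4.
-/

-- `Summit.<Summit>.<Problem>` is the tree's mandated summit-side namespace (CONVENTIONS §2); for this
-- single-conjunct summit the two coincide, so the duplicate is deliberate.
set_option linter.dupNamespace false

noncomputable section

open Set Function MeasureTheory Filter
open scoped InnerProductSpace

namespace Summit.AnomalousDissipation.AnomalousDissipation.Theorems.DenseLoudDesignerForces.Ergodic

open Literature.Analysis.FunctionSpaces Literature.Analysis.FunctionSpaces.Torus

/-- **Tools stub T7 of block N-R (`stub_gevreyInterpolationTools`, crux stmt-AnomalousDissipation-1143, line
`ergodic-budget-selection-closing`) — Gevrey interpolation on the lattice.**  For `σ > 0`, `G ≥ 0`, `m : ℕ` and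
`ε > 0` there is `δ > 0` such that every `c : ℤ^d → ℂ^d` with `∑_{k∈S} e^{2σ|k|} ‖c k‖² ≤ G` and
`∑_{k∈S} ‖c k‖² ≤ δ` for all finite `S` satisfies `∑_{k∈S} (1 + |k|²)^m ‖c k‖² ≤ ε` for all finite `S`
(`Torus.exists_sobolev_le_of_gevreyBound_of_l2_le` at `V = ℂ^d`: split low/high frequencies at
`|k| = R(σ, G, m, ε)`). [folklore] -/
theorem stub_gevreyInterpolationTools {d : Type*} [Fintype d] (σ G : ℝ) (hσ : 0 < σ) (hG : 0 ≤ G) (m : ℕ) (ε : ℝ) (hε : 0 < ε) :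
    ∃ δ : ℝ, 0 < δ ∧ ∀ c : (d → ℤ) → EuclideanSpace ℂ d,
      (∀ S' : Finset (d → ℤ), ∑ k ∈ S', Real.exp (2 * σ * Real.sqrt (freqNormSq k)) * ‖c k‖ ^ 2 ≤ G) →
      (∀ S' : Finset (d → ℤ), ∑ k ∈ S', ‖c k‖ ^ 2 ≤ δ) →
      ∀ S' : Finset (d → ℤ), ∑ k ∈ S', (1 + freqNormSq k) ^ m * ‖c k‖ ^ 2 ≤ ε :=
  exists_sobolev_le_of_gevreyBound_of_l2_le σ G hσ hG m ε hε

end Summit.AnomalousDissipation.AnomalousDissipation.Theorems.DenseLoudDesignerForces.Ergodic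

end
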